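import Mathlib
import HarnessLib
import Literature.Analysis.FluidPDE.AxisymmetricVorticityTransport
import Literature.Analysis.FluidPDE.PineauVicolRSS
import Literature.Analysis.FluidPDE.PineauVicolRSSHolds
import Summits.NavierStokesRegularity.NavierStokesRegularity.Theorems.PeepholeEchoDoorTwistedDoors

/-!
# PeepholeEchoDoorRSS — S23 «PeepholeEchoDoor» ADDENDUM-22R (twisted echoes), part 7/7

§6.7, the RSS stratum: twists drawn from a uniform rotation about the `e₃`-axis with angular speed `α` (twist at ratio `κ`
= `rotZ(−α log κ)`, tree `rotZLIE`).  A door-class decay profile echoing at EVERY ratio with these twists is Pineau–Vicol's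
backward rotated self-similar ansatz (1.7) (`pvAnsatz α U`, `U = v(−1,·)`), and PV 2026 Thm 1.4 (tree THEOREM
`pineauVicol2026_rss_liouville_holds`) kills it for `|α| < α₁(D)` or `|α| > α₂(D)`: residue `RSSEchoResidueAt D α` PROVED
outside the band (`rssEchoResidueAt_smallLarge`), everywhere from the canonical leaf (`rssEchoResidueAt_of_conjecture`, one
ratio suffices); doors `TargetRSSEchoAt ν M α` (`closesRSSEchoAt`), **T2-RSS `targetRSSEcho_holds : TargetRSSEcho` PROVED**
(«no slowly- or rapidly-twisting total echo»), `targetRSSEchoAt_of_conjecture`.  The band `α₁ ≤ |α| ≤ α₂` is PV Conj. 1.1 =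
Tsai GSM 192 Conj. 8.9 (OPEN) — hard core 10661, RSS stratum.

Door family of LADDER-NS N0; THEOREMS-ONLY landing of the nsreg-p1 design `run/shared/lean/pub/ns-regularity-ideate/ns-regularity-ideate-p1/r22/r22R/Sketch23R.lean`
(ADDENDUM-22R.md); no route, no items (DIRECTOR-NS standing #32 (2)). WHAT THIS IS NOT: not a regularity claim; not an attack on Tsai Conj. 8.9.
-/

noncomputable section

set_option linter.dupNamespace false

namespace Summit.NavierStokesRegularity.NavierStokesRegularity.Theorems.PeepholeEchoDoorRSS

open MeasureTheory Set Function Filter Topology TopologicalSpace Metric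
open scoped RealInnerProductSpace NNReal ENNReal Topology Pointwise
open Literature.Analysis Literature.Analysis.FluidPDE
open Summit.NavierStokesRegularity.NavierStokesRegularity.Theorems.LocalSineTubeDoorProfileAlignedWindowRigidityAncient
open Summit.NavierStokesRegularity.NavierStokesRegularity.Theorems.PoloidalWindowDoorPoloidalWindowRigidityStrata
open Summit.NavierStokesRegularity.NavierStokesRegularity.Theorems.PoloidalWindowDoorPoloidalWindowRigidityFlat
open Summit.NavierStokesRegularity.NavierStokesRegularity.Theorems.PoloidalWindowDoorPoloidalWindowRigidityWindow
open Summit.NavierStokesRegularity.NavierStokesRegularity.Theorems.PeepholeEchoDoorDefs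
open Summit.NavierStokesRegularity.NavierStokesRegularity.Theorems.PeepholeEchoDoorCore
open Summit.NavierStokesRegularity.NavierStokesRegularity.Theorems.PeepholeEchoDoorResidues
open Summit.NavierStokesRegularity.NavierStokesRegularity.Theorems.PeepholeEchoDoorDoors
open Summit.NavierStokesRegularity.NavierStokesRegularity.Theorems.PeepholeEchoDoorTwisted
open Summit.NavierStokesRegularity.NavierStokesRegularity.Theorems.PeepholeEchoDoorTwistedDoors

/-! ### §6.7 The RSS stratum: one-parameter twists about an axis (Pineau–Vicol 2026, Thm 1.4)

Twists drawn from a uniform rotation about the `e₃`-axis with angular speed `α` (in similarity time `s = −log(−t)`):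
the twist at ratio `κ` is `rotZ(−α log κ)` (tree `rotZLIE`).  A profile echoing at EVERY ratio with these twists is
backward ROTATED SELF-SIMILAR — Pineau–Vicol's ansatz (1.7), tree `pvAnsatz α U` with `U = v(−1, ·)` — and Pineau–Vicol
2026 Thm 1.4 (tree THEOREM `pineauVicol2026_rss_liouville_holds`) kills it for `|α| < α₁(D)` and `|α| > α₂(D)`; the band
in between is their Conjecture 1.1 = Tsai GSM 192 Conj. 8.9 (OPEN), itself inside the leaf's rotated half (one ratio
suffices: `rssEchoResidueAt_of_conjecture`).  The axis is the `e₃`-axis through `x₀`; a general axis is a rigid rotation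
of coordinates away (NS and every door hypothesis are rotation invariant) and is not spelled out. -/

section RSS

variable {C : ℝ} {v : ℝ → EuclideanSpace ℝ (Fin 3) → EuclideanSpace ℝ (Fin 3)}

/-- crux (rank 2″) · K2-RSS · THE RSS ECHO RESIDUE at decay constant `D` and angular speed `α`: a door-class decay profile
echoing at EVERY ratio `κ ∈ (0,1)` with the twist `rotZ(−α log κ)` is not backward-singular.  PROVED outside the band
(`rssEchoResidueAt_smallLarge`); the band is Tsai Conj. 8.9 / PV Conj. 1.1, implied by the leaf. -/
def RSSEchoResidueAt (D α : ℝ) : Prop :=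
  ∀ (C : ℝ) (v : ℝ → EuclideanSpace ℝ (Fin 3) → EuclideanSpace ℝ (Fin 3)), Literature.Analysis.FluidPDE.HasTypeITimeDecay C v → Literature.Analysis.FluidPDE.HasTypeIDecay D v → ContinuousOn (Function.uncurry v) (Set.Iio (0 : ℝ) ×ˢ Set.univ) → (∀ s t : ℝ, s < t → t < 0 → ∀ x, v t x = Literature.Analysis.UnboundedOperators.heatExtension (v s) (t - s) x - Literature.Analysis.FluidPDE.oseenDuhamel 1 s v v t x) → (∀ t < 0, Literature.Analysis.FluidPDE.VectorCalculus.IsDivFree (v t)) → (∀ κ : ℝ, 0 < κ → κ < 1 → HasTwistedSymmetry κ (Real.sqrt κ) (Literature.Analysis.FluidPDE.rotZLIE (-(α * Real.log κ))) v) → ¬ Literature.Analysis.FluidPDE.IsBackwardSingularPoint v 0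

/-- target (rank 0) · DOOR T2-RSS at angular speed `α`, SPACE–time local Type I with constants `ν, M`: local Type I at
`(x₀,T)` + twisted echoes at every ratio `κ ∈ (0,1)` with the twists `rotZ(−α log κ)` (each on its own open window) ⇒
backward bounded.  (CONDITIONAL on `RSSEchoResidueAt (M/ν) α`.) -/
def TargetRSSEchoAt (ν M α : ℝ) : Prop :=
  ∀ (T : ℝ), 0 < T → ∀ (u : ℝ → EuclideanSpace ℝ (Fin 3) → EuclideanSpace ℝ (Fin 3)) (p : ℝ → EuclideanSpace ℝ (Fin 3) → ℝ), Literature.Analysis.FluidPDE.IsClassicalNSSolutionOn (Set.Ico 0 T) ν 0 u p → Literature.Analysis.FluidPDE.IsLerayHopfOn T ν 0 (u 0) u → Literature.Analysis.FluidPDE.HasRapidSpatialDecay (u 0) → ∀ (x₀ : EuclideanSpace ℝ (Fin 3)) (ρ : ℝ), 0 < ρ → (∀ t ∈ Set.Ico 0 T, T - ρ ^ 2 < t → ∀ x ∈ Metric.ball x₀ ρ, ‖u t x‖ * (‖x - x₀‖ + Real.sqrt (ν * (T - t))) ≤ M) → (∀ κ : ℝ, 0 < κ → κ < 1 → ∃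 U : Set (EuclideanSpace ℝ (Fin 3)), IsOpen U ∧ U.Nonempty ∧ DefectFadesR T x₀ u κ (Real.sqrt κ) (Literature.Analysis.FluidPDE.rotZLIE (-(α * Real.log κ))) U) → Literature.Analysis.FluidPDE.IsBackwardBoundedAt u T x₀

/-- target (rank 0) · DOOR T2-RSS «no slowly- or rapidly-twisting total echo» (PROVED, Pineau–Vicol 2026 Thm 1.4 through
the peephole): for all constants `ν, M` there are `α₁, α₂ > 0` such that the door `TargetRSSEchoAt ν M α` holds for
every angular speed with `|α| < α₁` or `|α| > α₂`. -/
def TargetRSSEcho : Prop :=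
  ∀ (ν M : ℝ), 0 < ν → ∃ α₁ α₂ : ℝ, 0 < α₁ ∧ 0 < α₂ ∧ ∀ α : ℝ, (|α| < α₁ ∨ α₂ < |α|) → TargetRSSEchoAt ν M α

/-- **THE RSS ECHO RESIDUE OUTSIDE THE BAND (PROVED, Pineau–Vicol 2026 Thm 1.4 = tree `pineauVicol2026_rss_liouville_holds`).**
The profile slice `U = v(−1, ·)` is `C^∞` (KNSS class), the past-cut profile flow is classical on `[−1,0)` with the pressure
of `exists_isClassicalNSSolutionOn_Iio_of_isTypeIAncientMild`, obeys the Type-I bound (1.10) with constant `D`, and the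
all-ratio twisted symmetry is exactly the ansatz (1.7) (`pvAnsatz α`), read at `κ = −t`. -/
theorem rssEchoResidueAt_smallLarge (D : ℝ) :
    ∃ α₁ α₂ : ℝ, 0 < α₁ ∧ 0 < α₂ ∧ ∀ α : ℝ, (|α| < α₁ ∨ α₂ < |α|) → RSSEchoResidueAt D α := by
  rcases le_or_gt D 0 with hD | hD
  · refine ⟨1, 1, one_pos, one_pos, fun α _ => ?_⟩
    intro C v hrate hdecay hcont hmild hdiv hsym hsing
    exact not_backwardSingular_of_zero (eq_zero_of_hasTypeIDecay_nonpos hD hdecay) hsing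
  obtain ⟨α₁, α₂, hα₁, hα₂, hpv⟩ := pineauVicol2026_rss_liouville_holds D hD
  refine ⟨α₁, α₂, hα₁, hα₂, fun α hα => ?_⟩
  intro C v hrate hdecay hcont hmild hdiv hsym hsing
  have hclass : IsTypeIAncientMild C (pastCut v) :=
    isTypeIAncientMild_pastCut (isTypeIAncientMild_of_class hrate hcont hmild hdiv)
  obtain ⟨q, hq⟩ :=
    Summit.NavierStokesRegularity.NavierStokesRegularity.Theorems.exists_isClassicalNSSolutionOn_Iio_of_isTypeIAncientMild
      hclass
  have hsol : IsClassicalNSSolutionOn (Ico (-1) 0) 1 0 (pastCut v) q :=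
    hq.mono Ico_subset_Iio_self (uniqueDiffOn_Ico _ _)
  have hbound : ∀ t ∈ Ico (-1 : ℝ) 0, ∀ x : EuclideanSpace ℝ (Fin 3), ‖pastCut v t x‖ ≤ D / (‖x‖ + Real.sqrt (-t)) :=
    fun t ht x => by rw [pastCut_of_neg ht.2]; exact hdecay t ht.2 x
  -- the slice at `t = -1`
  obtain ⟨U, hUdef⟩ : ∃ U : EuclideanSpace ℝ (Fin 3) → EuclideanSpace ℝ (Fin 3), U = fun y => pastCut v (-1) y :=
    ⟨_, rfl⟩
  have hm1 : (-1 : ℝ) < 0 := by norm_num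
  have hU1 : ∀ y, U y = v (-1) y := fun y => by rw [hUdef, pastCut_of_neg hm1]
  have hUsmooth : ContDiff ℝ 2 U := by
    have h1 : ContDiff ℝ ((⊤ : ℕ∞) : WithTop ℕ∞)
        (uncurry (pastCut v) ∘ fun y : EuclideanSpace ℝ (Fin 3) => ((-1 : ℝ), y)) :=
      hclass.contDiffOn.comp_contDiff (contDiff_const.prodMk contDiff_id) fun y =>
        mk_mem_prod (mem_Iio.2 hm1) (mem_univ _)
    rw [hUdef]
    exact h1.of_le (by norm_cast)
  -- the all-ratio twisted symmetry is the rotated self-similar ansatz (1.7), read at `κ = -t`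
  have hansatz : ∀ t ∈ Ico (-1 : ℝ) 0, ∀ x : EuclideanSpace ℝ (Fin 3),
      pastCut v t x = pvAnsatz α (fun y _ => U y) t x := by
    intro t ht x
    have ht0 : t < 0 := ht.2
    have hnt : 0 < -t := neg_pos.2 ht0
    rw [pastCut_of_neg ht0]
    rcases eq_or_lt_of_le ht.1 with h1 | h1
    · rw [← h1]
      simp [pvAnsatz, hU1, rotZ_zero]
    · have hκ1 : -t < 1 := by linarith
      have hsκ : 0 < Real.sqrt (-t) := Real.sqrt_pos.2 hnt
      obtain ⟨R, hR⟩ : ∃ R : EuclideanSpace ℝ (Fin 3) ≃ₗᵢ[ℝ] EuclideanSpace ℝ (Fin 3),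
          R = rotZLIE (-(α * Real.log (-t))) := ⟨_, rfl⟩
      have hz := hsym (-t) hnt hκ1 (-1) hm1 (R.symm ((Real.sqrt (-t))⁻¹ • x))
      rw [← hR, LinearIsometryEquiv.apply_symm_apply, smul_smul, mul_inv_cancel₀ hsκ.ne', one_smul,
        show -t * -1 = t by ring] at hz
      have key : v t x = (Real.sqrt (-t))⁻¹ • R (v (-1) (R.symm ((Real.sqrt (-t))⁻¹ • x))) := by
        rw [hz, LinearIsometryEquiv.map_smul, LinearIsometryEquiv.apply_symm_apply, smul_smul,
          inv_mul_cancel₀ hsκ.ne', one_smul]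
      have e1 : α * -Real.log (-t) = -(α * Real.log (-t)) := by ring
      rw [key]
      simp only [pvAnsatz, hU1, e1, hR, rotZLIE_apply, rotZLIE_symm_apply, neg_neg]
  -- Pineau–Vicol: the profile slice vanishes, hence the whole profile
  have hU0 : U = 0 := hpv α (pastCut v) q U hsol hbound hUsmooth hansatz hα
  have hv1 : ∀ y, v (-1) y = 0 := fun y => by
    rw [← hU1 y, hU0]
    rfl
  have hzero : ∀ s < 0, ∀ z, v s z = 0 := by
    intro s hs z
    rcases lt_trichotomy s (-1) with h1 | h1 | h1
    · have hns : 1 < -s := by linarith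
      have hκ : 0 < (-s)⁻¹ := inv_pos.2 (zero_lt_one.trans hns)
      have hκ1 : (-s)⁻¹ < 1 := inv_lt_one_of_one_lt₀ hns
      have h := hsym (-s)⁻¹ hκ hκ1 s hs z
      have hm : (-s)⁻¹ * s = -1 := by rw [inv_neg, neg_mul, inv_mul_cancel₀ hs.ne]
      rw [hm, hv1, map_zero, smul_zero] at h
      exact h
    · rw [h1]
      exact hv1 z
    · have h := hansatz s ⟨h1.le, hs⟩ z
      rw [pastCut_of_neg hs] at h
      rw [h]
      simp only [pvAnsatz, hU0, Pi.zero_apply, ← rotZLIE_apply, map_zero, smul_zero]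
  exact not_backwardSingular_of_zero hzero hsing

/-- The band, and every `α`, from the canonical leaf (one ratio suffices). -/
theorem rssEchoResidueAt_of_conjecture
    (h : Summit.NavierStokesRegularity.NavierStokesRegularity.TypeIDSSLiouvilleConjecture) (D α : ℝ) :
    RSSEchoResidueAt D α := by
  intro C v hrate hdecay hcont hmild hdiv hsym
  have hκ : (0 : ℝ) < 1 / 4 := by norm_num
  have hκ1 : (1 / 4 : ℝ) < 1 := by norm_num
  exact echoResidueDecayAtR_of_wall hκ hκ1 _ ((h (Real.sqrt (1 / 4))⁻¹).2 _) D C v hrate hdecay hcont hmild hdiv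
    (hsym (1 / 4) hκ hκ1)

/-- The RSS door at `ν, M, α`: PROVED modulo `RSSEchoResidueAt (M/ν) α`. -/
theorem closesRSSEchoAt (ν M α : ℝ) (hν : 0 < ν) (h₂ : RSSEchoResidueAt (M / ν) α) : TargetRSSEchoAt ν M α := by
  intro T hT u p hcl hLH hdec x₀ ρ hρ hM hall
  by_contra hnot
  obtain ⟨C, v, hrate, hdecay, hcont, hmild, hdiv, hsing, huniv⟩ :=
    localPointZoomTwisted_decay ν T hν hT u p hcl hLH hdec x₀ ρ M hρ hM hnot
  refine h₂ C v hrate hdecay hcont hmild hdiv (fun κ hκ hκ1 => ?_) hsing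
  obtain ⟨U, hU, hUne, hfade⟩ := hall κ hκ hκ1
  exact huniv κ (Real.sqrt κ) hκ (Real.sqrt_pos.2 hκ) _ U hU hUne hfade

/-- **DOOR T2-RSS (PROVED).** -/
theorem targetRSSEcho_holds : TargetRSSEcho := by
  intro ν M hν
  obtain ⟨α₁, α₂, hα₁, hα₂, hres⟩ := rssEchoResidueAt_smallLarge (M / ν)
  exact ⟨α₁, α₂, hα₁, hα₂, fun α hα => closesRSSEchoAt ν M α hν (hres α hα)⟩

/-- **DOOR T2-RSS for every angular speed from the canonical leaf.** -/
theorem targetRSSEchoAt_of_conjecture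
    (h : Summit.NavierStokesRegularity.NavierStokesRegularity.TypeIDSSLiouvilleConjecture) (ν M α : ℝ) (hν : 0 < ν) :
    TargetRSSEchoAt ν M α :=
  closesRSSEchoAt ν M α hν (rssEchoResidueAt_of_conjecture h (M / ν) α)

end RSS

end Summit.NavierStokesRegularity.NavierStokesRegularity.Theorems.PeepholeEchoDoorRSS

end
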